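import Summits.HubbardSuperconductivity.HubbardSuperconductivity.Theses.AbsenceCertificate
import Literature.MathematicalPhysics.QuantumLattice.DWaveSourceProofs

/-!
# Route `AbsenceCertificate`: `SourceSlopeBound` (stmt-HubbardSuperconductivity-9490) and
# `UniversalSourcedVanishingGlue` (stmt-HubbardSuperconductivity-14523)

* `sourceSlopeBound_proof : SourceSlopeBound` — for every side `L`, `U`, `μ` and `h > 0`,
  `(E_L(0) − E_L(h))/(2h) ≤ L² · dWaveSourceDensity L U μ h`, `E_L(h)` the full-Fock ground energy of
  the sourced torus Hamiltonian `dWaveSourceTorus L U μ h = H − μN − h(Δ_d + Δ_dᴴ)`. This is the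
  Literature sandwich `groundEnergy_gain_le_dWaveSourceDensity`
  (`E_L(0) − E_L(h) ≤ 2hL²·dWaveSourceDensity`, the tracial ground state of `H_{L,h}` as a trial
  state for `H_{L,0}` — the supergradient inequality of the concave sourced energy) divided by `2h`.
* `universalSourcedVanishingGlue_proof : UniversalSourcedVanishingGlue` — pure logic:
  `CanonicalSupportingPotential → GlobalSourcedVanishing → UniversalSourcedVanishing` (fix `U > 0`,
  `δ ∈ (0, 1/2) ⊂ (0, 1)`; the canonical-support hypothesis gives `μ` with clause (a);
  `GlobalSourcedVanishing` at `(U, δ, μ, (a))` is clause (b)).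

Sources: T. Koma, H. Tasaki, J. Stat. Phys. 76 (1994) 745, §1 (sourced order parameter, concavity
in the source); R. B. Griffiths, J. Math. Phys. 5 (1964) 1215. No definition is introduced.
-/

set_option linter.dupNamespace false

noncomputable section

namespace Summit.HubbardSuperconductivity.HubbardSuperconductivity.Theorems.AbsenceCertificate

open Matrix Literature.MathematicalPhysics.QuantumLattice Literature.Probability.LatticeModels
open Summit.HubbardSuperconductivity.HubbardSuperconductivity.Theses.AbsenceCertificate

/-- **`SourceSlopeBound` holds** (route `AbsenceCertificate`, support item
`stmt-HubbardSuperconductivity-9490`): `(E_L(0) − E_L(h))/(2h) ≤ L² · dWaveSourceDensity L U μ h` for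
`h > 0` — the supergradient inequality of the concave sourced ground energy, i.e. the Literature
lemma `groundEnergy_gain_le_dWaveSourceDensity` divided by `2h`. Koma–Tasaki, J. Stat. Phys. 76
(1994) 745, §1. [cite: KomaTasaki1994] -/
theorem sourceSlopeBound_proof : SourceSlopeBound := by
  intro L _ U μ h hh
  rw [div_le_iff₀ (by positivity)]
  have := groundEnergy_gain_le_dWaveSourceDensity (L := L) U μ h
  linarith

/-- **`UniversalSourcedVanishingGlue` holds** (route `AbsenceCertificate`, support item
`stmt-HubbardSuperconductivity-14523`): the canonical supporting potential and the global sourced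
vanishing give the universal sourced vanishing (pure logic; `(0, 1/2) ⊂ (0, 1)`). [folklore] -/
theorem universalSourcedVanishingGlue_proof : UniversalSourcedVanishingGlue := by
  intro hCSP hG U hU δ hδ
  obtain ⟨μ, hμ⟩ := hCSP U δ ⟨hδ.1, hδ.2.trans (by norm_num)⟩
  exact ⟨μ, hμ, hG U hU δ hδ μ hμ⟩

end Summit.HubbardSuperconductivity.HubbardSuperconductivity.Theorems.AbsenceCertificate
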